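import Summits.Ventures.CertifiedArithmetic.LowPrec.GemmThetaLawE2M1Law
import Summits.Ventures.CertifiedArithmetic.LowPrec.GemmThetaLawE2M1Checks

/-!
# The θ-certificate of E2M1² at EVERY precision `p ≥ 9`, kernel-checked (paper Thm t:thetap (iii))

HONEST FRAMING (venture CertifiedArithmetic / cell `pub-lowprec`, seat gemm, gen 12): certified error
envelopes and provably optimal rounding/accumulation schemes for low-precision formats under stated
cost models; every table by two implementations; no hardware or vendor claims.

THE RESULT.  For every format `φ` with `m = φ.manBits ≥ 8` (precision `p = m + 1 ≥ 9`), quantum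
at most `1/4` (`φ.qexp ≤ -2`) and range at least `2^(m+8)` (no overflow on the state space), the
hypotheses of the θ-certificate (`GemmThetaCertificate.lean`) hold for sequential round-to-nearest-
even accumulation of E2M1·E2M1 products in `φ` with
`θ_p = (13·2^(m-1) + 8)/32 = 13·2^(p-7) + 1/4`, `ρ = 7/2`, `β_pair = 23/2`, `κ = 1/θ_p`
(`thetaCert_E2M1_prec`); hence for every input of `n = m' + 1` products, not all zero,
`θ_p/(n + 25 θ_p/2) ≤ 1 - (ŝ - Σ x)/Σ|x|` (`defect_bound_E2M1_prec`) and
`|ŝ - Σ x| ≤ (1 - θ_p/(n + 25 θ_p/2)) Σ|x|` (`abs_err_le_E2M1_prec`); instance IEEE binary32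
(`p = 24`, `θ = 13·2^17 + 1/4`): `|ŝ - Σ a_j b_j| ≤ (1 - 13631490/(8n + 170393625)) Σ|a_j b_j|`
(`abs_dot_err_le_E2M1_Binary32`).  This is the SUP side of paper `gemm.tex` §Regimes Thm t:thetap
(iii) for all `p ≥ 9` as ONE kernel-checked theorem (previously: two independent implementations,
kernel-checked only at the instances `p = 8` (`GemmThetaE2M1.lean`: θ = 105/4 = 13·2 + 1/4, the law
value; the symbolic classes below need `M = 2^(p-1) ≥ 256`, so `p = 8` stays that instance) and
`p = 11` (`GemmThetaE2M1Fp16.lean`, binary16, whose overflow threshold truncates the state space;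
formats with `maxRat < 2^(m+8)` are not instances of the present theorem)).

THE PROOF is the symbolic `(H, T)`-affine certificate: `GemmThetaLawSym.lean` (symbolic RNE),
`GemmThetaLawE2M1Defs.lean` (1313 magnitude classes, potentials, edge and pair checks),
`GemmThetaLawE2M1Check01…07.lean` + `…Checks.lean` (`decide +kernel`), `…Sound.lean`, `…Edge.lean`,
`…Law.lean` (soundness at every parameter), and `GemmPrecRounding.lean` (the quarter grid of `φ`).
-/

namespace Literature.ComputerArithmetic.FloatingPoint

namespace MiniFloat

open Finset
open ThetaE2M1 (lamQ natAbs_le_of_mem_lamQ exists_of_mem_piE2M1)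
open ThetaLawE2M1 ThetaLaw

variable {φ : Format}

/-! ### States, potential and θ as functions of the format -/

/-- The state predicate on values: a quarter-grid point of `stZ φ.manBits`. [cell] -/
def SP (φ : Format) (v : ℚ) : Prop := ∃ V : ℤ, stZ φ.manBits V ∧ v = (V : ℚ) / 4

/-- The potential on values (quarter units inside). [cell] -/
def psiP (φ : Format) (v : ℚ) : ℚ := (psiZp φ.manBits ⌊v * 4⌋ : ℚ) / 4

/-- `ψ` on the quarter grid. [folklore] -/
theorem psiP_quarter (V : ℤ) : psiP φ ((V : ℚ) / 4) = (psiZp φ.manBits V : ℚ) / 4 := by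
  unfold psiP
  rw [div_mul_cancel₀ (V : ℚ) (by norm_num : (4 : ℚ) ≠ 0), Int.floor_intCast]

/-- `θ_p = (13·2^(m-1) + 8)/32 = 13·2^(p-7) + 1/4` (`m = p - 1`). [gemm.tex Thm t:thetap (iii)] -/
def thetaP (m : ℕ) : ℚ := (13 * 2 ^ (m - 1) + 8) / 32

/-- `θ_p > 0`. [folklore] -/
theorem thetaP_pos (m : ℕ) : 0 < thetaP m := by unfold thetaP; positivity

/-- No overflow: a state plus a letter stays inside the range hypothesis. [cell] -/
theorem quarter_range_of_stZ (hm : 8 ≤ φ.manBits) (hR : (2 : ℚ) ^ (φ.manBits + 8) ≤ φ.maxRat)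
    {V Q : ℤ} (hV : stZ φ.manBits V) (hQ : Q ∈ lamQ) :
    (((V + Q).natAbs : ℕ) : ℚ) / 4 ≤ φ.maxRat := by
  apply quarter_le_maxRat_of_lt hR
  have h1 := natAbs_le_of_stZ hV
  have h2 := natAbs_le_of_mem_lamQ hQ
  have h3 : (V + Q).natAbs ≤ V.natAbs + Q.natAbs := Int.natAbs_add_le V Q
  have h4 : 144 < 2 ^ (φ.manBits + 9) :=
    calc 144 < 2 ^ 8 := by norm_num
      _ ≤ 2 ^ (φ.manBits + 9) := Nat.pow_le_pow_right (by norm_num) (by omega)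
  have h5 : 2 ^ (φ.manBits + 10) = 2 ^ (φ.manBits + 9) + 2 ^ (φ.manBits + 9) := by
    rw [pow_succ]; ring
  omega

/-! ### The certificate -/

/-- THE θ-CERTIFICATE OF E2M1² AT EVERY PRECISION `p ≥ 9`: for every format `φ` with
`φ.manBits ≥ 8`, `φ.qexp ≤ -2` and `2^(manBits+8) ≤ φ.maxRat`, the seven facts of
`ThetaCertificate` hold with `θ = θ_p`, `ρ = 7/2`, `β_pair = 23/2`, `κ = 1/θ_p`.
[cell, gemm.tex §Regimes Thm t:thetap (iii) — now a theorem for all `p ≥ 9`] -/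
theorem thetaCert_E2M1_prec (φ : Format) (hm : 8 ≤ φ.manBits) (hq : φ.qexp ≤ -2)
    (hR : (2 : ℚ) ^ (φ.manBits + 8) ≤ φ.maxRat) :
    ThetaCertificate φ (fun q => q ∈ piE2M1) (SP φ) (psiP φ) (thetaP φ.manBits) (7 / 2) (23 / 2)
      (1 / thetaP φ.manBits) := by
  have hθ := thetaP_pos φ.manBits
  have hθH : thetaP φ.manBits * 32 = ((13 * (2 : ℤ) ^ (φ.manBits - 1) + 8 : ℤ) : ℚ) := by
    unfold thetaP; push_cast; ring
  -- the integer law, instantiated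
  have law : ∀ {V x : ℤ}, stZ φ.manBits V → x ∈ lamQ → _ :=
    fun {V x} hV hx => lawZ_of_checks hm cls_ok pair_ok hV hx
  refine
    { θ_pos := hθ
      ρ_nonneg := by norm_num
      βp_nonneg := by norm_num
      κ_nonneg := by positivity
      start := ?_, closed := ?_, potential := ?_, capacity := ?_, paid := ?_, free := ?_ }
  · intro q hq'
    obtain ⟨Q, hQ, rfl⟩ := exists_of_mem_piE2M1 hq'
    have hb := natAbs_le_of_mem_lamQ hQ
    have hlt : Q.natAbs < 2 ^ (φ.manBits + 1) :=
      lt_of_le_of_lt hb (lt_of_lt_of_le (by norm_num) (Nat.pow_le_pow_right (by norm_num)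
        (show 8 ≤ φ.manBits + 1 by omega)))
    have hrng : ((Q.natAbs : ℕ) : ℚ) / 4 ≤ φ.maxRat :=
      quarter_le_maxRat_of_lt hR (lt_of_lt_of_le hlt (Nat.pow_le_pow_right (by norm_num) (by omega)))
    refine ⟨exists_toRat_eq_quarter_prec hq hlt hrng, ⟨Q, Or.inl hlt, rfl⟩, ?_⟩
    rw [psiP_quarter, psiZp_of_natAbs_lt _ hlt, abs_div, abs_of_pos (by norm_num : (0 : ℚ) < 4),
      ← Int.cast_abs, ← Int.natCast_natAbs]
  · rintro v q ⟨V, hV, rfl⟩ hq'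
    obtain ⟨Q, hQ, rfl⟩ := exists_of_mem_piE2M1 hq'
    rw [flStep_quarter_prec hq (quarter_range_of_stZ hm hR hV hQ)]
    exact ⟨_, (law hV hQ).1, rfl⟩
  · rintro v q ⟨V, hV, rfl⟩ hq' hne
    obtain ⟨Q, hQ, rfl⟩ := exists_of_mem_piE2M1 hq'
    have hr := quarter_range_of_stZ hm hR hV hQ
    rw [flStep_quarter_prec hq hr] at hne ⊢
    rw [psiP_quarter, psiP_quarter, deficitOf_quarter_prec hq hr]
    have hne' : rneZ φ.manBits (V + Q) ≠ V := fun h => hne (by rw [h])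
    have h3 := (law hV hQ).2.2.1 hne'
    have h3' : ((psiZp φ.manBits (rneZ φ.manBits (V + Q)) : ℤ) : ℚ)
        ≤ ((psiZp φ.manBits V + ((Q.natAbs : ℤ) - (rneZ φ.manBits (V + Q) - V - Q)) : ℤ) : ℚ) := by
      exact_mod_cast h3
    push_cast at h3' ⊢
    linarith
  · rintro v q ⟨V, hV, rfl⟩ hq' habs hneg
    obtain ⟨Q, hQ, rfl⟩ := exists_of_mem_piE2M1 hq'
    have hr := quarter_range_of_stZ hm hR hV hQ
    rw [flStep_quarter_prec hq hr, quarter_eq_iff] at habs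
    have hQ0 : Q < 0 := by
      have : (Q : ℚ) < 0 := by linarith
      exact_mod_cast this
    have h2 := (law hV hQ).2.1 habs hQ0
    have h2' : (((13 * (2 : ℤ) ^ (φ.manBits - 1) + 8) * -Q : ℤ) : ℚ)
        ≤ ((32 * psiZp φ.manBits V : ℤ) : ℚ) := by exact_mod_cast h2
    rw [psiP_quarter]
    push_cast at h2' hθH
    nlinarith
  · rintro v q ⟨V, hV, rfl⟩ hq' hne hpos
    obtain ⟨Q, hQ, rfl⟩ := exists_of_mem_piE2M1 hq'
    have hr := quarter_range_of_stZ hm hR hV hQ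
    rw [flStep_quarter_prec hq hr] at hne
    rw [deficitOf_quarter_prec hq hr] at hpos ⊢
    rw [gainOf_quarter_prec hq hr]
    have hne' : rneZ φ.manBits (V + Q) ≠ V := fun h => hne (by rw [h])
    have hpos' : (0 : ℤ) < (Q.natAbs : ℤ) - (rneZ φ.manBits (V + Q) - V - Q) := by
      have : (0 : ℚ) < (((Q.natAbs : ℤ) - (rneZ φ.manBits (V + Q) - V - Q) : ℤ) : ℚ) := by
        linarith
      exact_mod_cast this
    have h4 := (law hV hQ).2.2.2.1 hne' hpos'
    have h4' : ((2 * (rneZ φ.manBits (V + Q) - V - Q) : ℤ) : ℚ)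
        ≤ ((7 * ((Q.natAbs : ℤ) - (rneZ φ.manBits (V + Q) - V - Q)) : ℤ) : ℚ) := by
      exact_mod_cast h4
    push_cast at h4' ⊢
    linarith
  · rintro v q ⟨V, hV, rfl⟩ hq' hne hd0
    obtain ⟨Q, hQ, rfl⟩ := exists_of_mem_piE2M1 hq'
    have hr := quarter_range_of_stZ hm hR hV hQ
    rw [flStep_quarter_prec hq hr] at hne ⊢
    rw [deficitOf_quarter_prec hq hr] at hd0
    rw [gainOf_quarter_prec hq hr, psiP_quarter]
    have hne' : rneZ φ.manBits (V + Q) ≠ V := fun h => hne (by rw [h])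
    have hd0' : ¬ (0 : ℤ) < (Q.natAbs : ℤ) - (rneZ φ.manBits (V + Q) - V - Q) := by
      have : ((((Q.natAbs : ℤ) - (rneZ φ.manBits (V + Q) - V - Q)) : ℤ) : ℚ) = 0 := by
        linarith
      have : (Q.natAbs : ℤ) - (rneZ φ.manBits (V + Q) - V - Q) = 0 := by exact_mod_cast this
      omega
    obtain ⟨hκ, hpair⟩ := (law hV hQ).2.2.2.2 hne' hd0'
    refine ⟨?_, ?_⟩
    · have hκ' : (((13 * (2 : ℤ) ^ (φ.manBits - 1) + 8) * (rneZ φ.manBits (V + Q) - V - Q) : ℤ) : ℚ)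
          ≤ ((32 * psiZp φ.manBits V : ℤ) : ℚ) := by exact_mod_cast hκ
      push_cast at hκ' hθH ⊢
      rw [← hθH] at hκ'
      have hδ : ((rneZ φ.manBits (V + Q) : ℤ) : ℚ) - V - Q
          ≤ (psiZp φ.manBits V : ℚ) / thetaP φ.manBits := by
        rw [le_div_iff₀ hθ]; linarith
      calc (((rneZ φ.manBits (V + Q) : ℤ) : ℚ) - V - Q) / 4
          ≤ ((psiZp φ.manBits V : ℚ) / thetaP φ.manBits) / 4 :=
            div_le_div_of_nonneg_right hδ (by norm_num)
        _ = 1 / thetaP φ.manBits * ((psiZp φ.manBits V : ℚ) / 4) := by ring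
    · intro q' hq'' hne''
      obtain ⟨Q', hQ', rfl⟩ := exists_of_mem_piE2M1 hq''
      have hW : stZ φ.manBits (rneZ φ.manBits (V + Q)) := (law hV hQ).1
      have hr' := quarter_range_of_stZ hm hR hW hQ'
      rw [flStep_quarter_prec hq hr'] at hne''
      rw [gainOf_quarter_prec hq hr', deficitOf_quarter_prec hq hr']
      rcases hpair Q' hQ' with h | h
      · exact absurd (by rw [h]) hne''
      · have h' : ((2 * ((rneZ φ.manBits (V + Q) - V - Q)
              + (rneZ φ.manBits (rneZ φ.manBits (V + Q) + Q') - rneZ φ.manBits (V + Q) - Q')) : ℤ) : ℚ)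
            ≤ ((23 * ((Q'.natAbs : ℤ) - (rneZ φ.manBits (rneZ φ.manBits (V + Q) + Q')
              - rneZ φ.manBits (V + Q) - Q')) : ℤ) : ℚ) := by
          exact_mod_cast h
        push_cast at h' ⊢
        linarith

/-! ### The bound -/

/-- THM t:thetap (iii) SUP SIDE, KERNEL-CHECKED FOR EVERY `p ≥ 9`: for every format `φ` as above
and every input of E2M1·E2M1 products `x 0, …, x m'` (`n = m' + 1` terms, not all zero)
accumulated sequentially in `φ` (RNE), `θ_p/(n + 25 θ_p/2) ≤ 1 - (ŝ - Σ x)/Σ|x|`, i.e. the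
worst-case relative error satisfies `W_p(n) ≤ 1 - θ_p/(n + 25θ_p/2)`.
[cell, gemm.tex §Regimes Thm t:thetap (iii)] -/
theorem defect_bound_E2M1_prec (φ : Format) (hm : 8 ≤ φ.manBits) (hq : φ.qexp ≤ -2)
    (hR : (2 : ℚ) ^ (φ.manBits + 8) ≤ φ.maxRat) (x : ℕ → ℚ) (hx : ∀ j, x j ∈ piE2M1) (m : ℕ)
    (hL : 0 < ∑ j ∈ range (m + 1), |x j|) :
    thetaP φ.manBits / ((m + 1 : ℚ) + 25 / 2 * thetaP φ.manBits)
      ≤ 1 - ((seqSum φ x m).toRat - ∑ j ∈ range (m + 1), x j) / ∑ j ∈ range (m + 1), |x j| := by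
  have h := (thetaCert_E2M1_prec φ hm hq hR).defect_bound x hx m hL
  have hθ := thetaP_pos φ.manBits
  have key : (m : ℚ) + thetaP φ.manBits * (1 + (max (7 / 2 : ℚ) (23 / 2) + 1 / thetaP φ.manBits))
      = (m + 1 : ℚ) + 25 / 2 * thetaP φ.manBits := by
    rw [max_eq_right (by norm_num)]
    field_simp
    ring
  rw [key] at h
  exact h

/-- TWO-SIDED FORM: `|ŝ - Σ x| ≤ (1 - θ_p/(n + 25θ_p/2)) · Σ|x|` for every input of E2M1·E2M1
products into `φ`. [cell, gemm.tex §Regimes Thm t:thetap (iii)] -/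
theorem abs_err_le_E2M1_prec (φ : Format) (hm : 8 ≤ φ.manBits) (hq : φ.qexp ≤ -2)
    (hR : (2 : ℚ) ^ (φ.manBits + 8) ≤ φ.maxRat) (x : ℕ → ℚ) (hx : ∀ j, x j ∈ piE2M1) (m : ℕ) :
    |(seqSum φ x m).toRat - ∑ j ∈ range (m + 1), x j|
      ≤ (1 - thetaP φ.manBits / ((m + 1 : ℚ) + 25 / 2 * thetaP φ.manBits))
          * ∑ j ∈ range (m + 1), |x j| := by
  have hθ := thetaP_pos φ.manBits
  by_cases hL : ∑ j ∈ range (m + 1), |x j| = 0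
  · have hz : ∀ j ∈ range (m + 1), x j = 0 := by
      intro j hj
      have := (sum_eq_zero_iff_of_nonneg fun i _ => abs_nonneg (x i)).mp hL j hj
      exact abs_eq_zero.mp this
    have hs : ∀ k ≤ m, (seqSum φ x k).toRat = 0 := by
      intro k hk
      induction k with
      | zero => simp [seqSum, hz 0 (by simp), toRat_roundNE_zero]
      | succ k ih =>
          simp only [seqSum]
          rw [ih (by omega), hz (k + 1) (mem_range.mpr (by omega)), add_zero, toRat_roundNE_zero]
    rw [hs m le_rfl, sum_eq_zero hz, hL]; simp
  · have hpos : 0 < ∑ j ∈ range (m + 1), |x j| :=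
      lt_of_le_of_ne (sum_nonneg fun i _ => abs_nonneg (x i)) (Ne.symm hL)
    have hc : (0 : ℚ) ≤ 1 - thetaP φ.manBits / ((m + 1 : ℚ) + 25 / 2 * thetaP φ.manBits) := by
      rw [sub_nonneg, div_le_one (by positivity)]
      linarith [show (0 : ℚ) ≤ m from Nat.cast_nonneg m]
    have h1 := defect_bound_E2M1_prec φ hm hq hR x hx m hpos
    have hx' : ∀ j, (fun j => -x j) j ∈ piE2M1 := fun j => neg_mem_piE2M1 (hx j)
    have h2 := defect_bound_E2M1_prec φ hm hq hR (fun j => -x j) hx' m (by simpa using hpos)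
    simp only [abs_neg, sum_neg_distrib, toRat_seqSum_neg] at h2
    rw [abs_le]
    constructor
    · have := (le_sub_comm.mp h2)
      rw [div_le_iff₀ hpos] at this
      linarith
    · have := (le_sub_comm.mp h1)
      rw [div_le_iff₀ hpos] at this
      linarith

/-! ### Instance: IEEE binary32 (`p = 24`) -/

/-- binary32 satisfies the three format hypotheses. [cite: IEEE7542019, Table 3.5] -/
theorem Binary32_prec_hyps : 8 ≤ Format.Binary32.manBits ∧ Format.Binary32.qexp ≤ -2 ∧
    (2 : ℚ) ^ (Format.Binary32.manBits + 8) ≤ Format.Binary32.maxRat := by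
  refine ⟨by decide, by decide, ?_⟩
  rw [Format.Binary32_maxRat.1, show Format.Binary32.manBits = 23 from rfl]
  norm_num

/-- `θ_24 = 13·2^17 + 1/4`. [gemm.tex Thm t:thetap (iii)] -/
theorem thetaP_Binary32 : thetaP Format.Binary32.manBits = 13 * 2 ^ 17 + 1 / 4 := by
  rw [show Format.Binary32.manBits = 23 from rfl]; unfold thetaP; norm_num

/-- E2M1² INTO binary32, SEQUENTIAL RNE: for every `n = m + 1` pairs of E2M1 data `a j, b j`
(exact products), `|ŝ - Σ a_j b_j| ≤ (1 - 13631490/(8n + 170393625)) · Σ|a_j b_j|`, i.e.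
`W_24(n) ≤ 1 - θ/(n + 25θ/2)` with `θ = 13·2^17 + 1/4`. [cell, gemm.tex §Regimes Thm t:thetap] -/
theorem abs_dot_err_le_E2M1_Binary32 (a b : ℕ → MiniFloat Format.E2M1) (m : ℕ) :
    |(seqSum Format.Binary32 (fun j => (a j).toRat * (b j).toRat) m).toRat
        - ∑ j ∈ range (m + 1), (a j).toRat * (b j).toRat|
      ≤ (1 - 13631490 / (8 * (m + 1 : ℚ) + 170393625))
          * ∑ j ∈ range (m + 1), |(a j).toRat * (b j).toRat| := by
  obtain ⟨h1, h2, h3⟩ := Binary32_prec_hyps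
  have h := abs_err_le_E2M1_prec Format.Binary32 h1 h2 h3 _ (fun j => mul_mem_piE2M1 (a j) (b j)) m
  rw [thetaP_Binary32] at h
  have key : (1 - (13 * 2 ^ 17 + 1 / 4 : ℚ) / ((m + 1 : ℚ) + 25 / 2 * (13 * 2 ^ 17 + 1 / 4)))
      = 1 - 13631490 / (8 * (m + 1 : ℚ) + 170393625) := by
    rw [sub_right_inj, div_eq_div_iff (by positivity) (by positivity)]
    ring
  rw [key] at h
  exact h

end MiniFloat

end Literature.ComputerArithmetic.FloatingPoint
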